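import Summits.QuantumFields.BalabanUV.T4Continuum.Support.RegionTwoZoneLocal
import Summits.QuantumFields.BalabanUV.T4Continuum.Support.RegionTwoZoneScalar

/-!
# T⁴ programme, spine node NE2 (U1a), sub-row Δ1 «NE2⁰-Dirichlet» — PRINT's TWO-ZONE GAUGE-FIXED OPERATOR TYPED FAITHFULLY:
# `Δ_a(Ω₀) = ∂*∂ + ∂_{Ω₀}·R(Ω₀)·∂_{Ω₀}* + a n^d QᴴQ + a n²·1_{Λ₀}` on the star bonds of the OUTER region, `R(Ω₀)` the projection IN `L²(Ω₀)`
# onto `Δ′N(Q′)`, `N(Q′) = {λ = 0 on Λ₀, Q′₁λ = 0}`; its `SliceData` PROVED, «`G(Ω₀) = Δ_a(Ω₀)⁻¹` EXISTS» for every collared pair, its bound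
# ⟺ ONE displayed slice inequality, and the resolvent split `Δ_a(Ω₀) = localTZ − ∂_{Ω₀}·P(Ω₀)·∂_{Ω₀}ᴴ`

NE2 formalisation swarm `b2b-balaban-t4-ne2-formalise-*`, LEAF PROVER 05 (gen 10), own-initiative supplier brick «Δ1-COLLAR-GAUGE», file 2 of 2
(file 1 `Support/RegionTwoZoneScalar`: the collared scalar data `QsC`, `DpC`, `GOmC`; companion `Support/RegionTwoZoneLocal`: the LOCAL operator
`localTZ`, its uniform Gaffney bound and coercivity).  For gen 16's ITEM 1 = the dictionary fork G-ne2p1-g15-6 (owner R44 (c) / R45 (d);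
T4-DAG writer's ANSWER Q51 «type the collar … region := carrier ∪ Λ₀ on star bonds + ONE added form term», journal 2026-08-21 l.24324;
this seat's located readings (R1)/(R2) in `RegionTwoZoneLocal`, INTENT l.24547).

WHAT IS PRINTED — verbatim sentences in the two companion headers: [Balaban1984PropagatorsII] (2.3)/(2.7)/(2.10)/(2.17)/(2.20) pp.224–226,
[Balaban1985BackgroundPropagators] (3.16)/(3.20)–(3.22)/(3.24)–(3.27) pp.393–395.  In short: `Δ_a = ∂*∂ + DRD* + Q*aQ` compressed to the star
bonds of `Ω₀ ⊋ Ω₁`; `Q*aQ` = `j = 1` block averaging + `j = 0` η-scale mass on `Λ₀ = st(Ω₀) ∖ st(Ω₁)`; `R` = the orthogonal projection IN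
`L²(Ω₀)` onto `Δ′N(Q′)` («R = R(U) is an orthogonal projection in the Hilbert space L²(Ω₀, g)», (3.20)–(3.21)).

WHAT THIS FILE TYPES AND PROVES ([folklore] finite-dimensional bookkeeping over landed modules BY NAME; `U = 1`; 0 sorry).
 * §2 **`sliceData_collar (hsub) (ha′)`** `: SliceData (curlR S₀) (gradR S₀) DpC GOmC QsC (Qv₂ S₀ S₁) Dg₁C` — curl ∘ grad (tree), the
   intertwiner `Dg₁C` of «Q∂ = ∂₁Q′» produced by file 1's `factor_of_ker` from the kernel inclusion **`Qv₂_gradR_mulVec_of_ker`** (`λ ∈ N(Q′) ⟹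
   Qv₂·∂_{Ω₀}λ = 0`: unit rows by «Q∂ = ∂₁Q′» through `Ω₀`, collar rows because a collar bond has no end in `Ω₁`), `DpC_mulVec_of_ker`, `G′`
   Hermitian two-sided inverse, `Q′G′²Q′ᴴ` invertible (generic `isUnit_det_gramK` with `Q′Q′ᴴ = n^{−d}·1`).
 * §3 **`regionDeltaC := gaugeFixed (curlR S₀) (gradR S₀) GOmC QsC (Qv₂ S₀ S₁) a`**; **`regionDeltaC_eq_localTZ_sub`** (owner's resolvent split:
   `= localTZ − ∂_{Ω₀}·P_c·∂_{Ω₀}ᴴ`); `form_regionDeltaC` (`‖curl A‖² + ‖R_c ∂_{Ω₀}ᴴA‖² + a n^d‖QA‖² + a n²‖A_{Λ₀}‖²`);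
   `form_regionDeltaC_le_form_localTZ`; **`isUnit_det_regionDeltaC (hsub) (ha) (ha′)`** — «G(Ω₀) EXISTS» for EVERY collared pair (zero
   averages kill the collar components, then `flat_region` on `Ω₁`, the gauge extended by zero lies in `N(Q′)`);
   **`opNorm_inv_regionDeltaC_le_of_slice`** (`SliceCoercive … c → ‖G(Ω₀)‖ ≤ max(2/c, 2γ′⁻¹)`), converse `sliceCoercive_collar_of_coercive`.
 * §4 BUDGETS OF THE LOCAL COLLARED PROPAGATOR `localTZ⁻¹` from file `RegionTwoZoneLocal`'s coercivity (the owner's `Ebud` style, every inner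
   geometry): `nsq_inv_le` (amplitude `gamTZ⁻²`), `form_inv_le` (energy `gamTZ⁻¹`), **`collar_nsq_inv_le`** (`a n²·‖(localTZ⁻¹f)_{Λ₀}‖² ≤ gamTZ⁻¹‖f‖²`:
   the propagator is `O(n⁻¹)` on the massive layer), **`gradEnergy_inv_le`** (`Σ_ν‖∇_ν ext(localTZ⁻¹f)‖² ≤ (1 + 4d/a)·gamTZ⁻¹·‖f‖²`).

WHAT IS NOT CLAIMED.  The displayed inequality `SliceCoercive (curlR S₀) (gradR S₀) GOmC QsC (Qv₂ S₀ S₁) a c` (W1 for PRINT's collared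
operator) is NOT proved for any pair — and gen 8's comparison `SliceCoercive ⟺ OrthSliceCoercive` does NOT transfer verbatim (its `κ` =
coercivity of `G′` on `range Q′ᴴ` degenerates like `n^{−2}` on the `Λ₀`-site functions); no two-level law / rate; [B9]'s graded layers and the
background are not modelled; the c5/B0 dictionary ruling stays with its owners.

HONEST FRAMING (T4-DAG p. 1).  Model level (`U = 1`, two zones, ONE averaging scale, finite torus, operator norm); constants OURS; nothing
printed is a hypothesis or a conclusion; NE2 (U1a) NOT proved; spine PROVED 0/9 unchanged; NOT [B9] (3.16)/(3.23)–(3.27) as printed; NOT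
infinite volume / mass gap / Clay.  HONEST DEPENDENCY: continuum YM on T⁴ ⇐ BetaPertH ∧ nine spine estimates (0/9 proved); BetaPertH ⇐
(D1) ∧ (D4) ∧ CAP+tail; G-an2-4 gates asym, D1 and NE2/3/4.  No `sorry`.
-/

noncomputable section

open scoped BigOperators ComplexConjugate Matrix Matrix.Norms.L2Operator
open Finset

namespace Summit.QuantumFields.BalabanUV.T4Continuum.RegionTwoZoneGauge

open Literature.MathematicalPhysics.QuantumFieldTheory.Balaban1983to89.B5Prop11Plancherel (Tor fine unitVec fdiff)
open Literature.MathematicalPhysics.QuantumFieldTheory.Balaban1983to89.B5Prop11Lower (nsq nsq_nonneg nsq_mulVec_le)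
open Literature.MathematicalPhysics.QuantumFieldTheory.Balaban1983to89.B5Action121 (GradOp)
open Literature.MathematicalPhysics.QuantumFieldTheory.Balaban1983to89.B5Block118 (QsOp bpt)
open Literature.MathematicalPhysics.QuantumFieldTheory.Balaban1983to89.B5Blocks16 (blockOf blockOf_bpt)
open Summit.QuantumFields.BalabanUV.T4Continuum
open Summit.QuantumFields.BalabanUV.T4Continuum.SubtypeCompression (Coercive ext ext_apply_of ext_apply_of_not)
open Summit.QuantumFields.BalabanUV.T4Continuum.ScalarAveragedPropagator (gammaPs gammaPs_pos re_star_dotProduct_le)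
open Summit.QuantumFields.BalabanUV.T4Continuum.RegionGaugeProjection (gramK gaugeP gaugeR isUnit_det_gramK norm_pos_of_mul_eq_one)
open Summit.QuantumFields.BalabanUV.T4Continuum.RegionGaugeSlice (gaugeFixed SliceData SliceCoercive form_gaugeFixed
  opNorm_inv_gaugeFixed_le_of_slice sliceCoercive_of_coercive isUnit_det_gaugeFixed_of_flat)
open Summit.QuantumFields.BalabanUV.T4Continuum.RegionScalarCompression (QOm)
open Summit.QuantumFields.BalabanUV.T4Continuum.RegionGaugeFixedVector (starReg curlR gradR avgR curlR_mul_gradR avgR_mul_gradR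
  GradOp_apply_eq_zero_of_not_star)
open Summit.QuantumFields.BalabanUV.T4Continuum.RegionGaugeFixedVectorFlat (avgR_mulVec flat_region)
open Summit.QuantumFields.BalabanUV.T4Continuum.RegionGaugeSliceTorus (curlR_mulVec)
open Summit.QuantumFields.BalabanUV.T4Continuum.RegionGaugeTwoZone (collar selC selC_mulVec Qv₂ nsq_Qv₂_mulVec inner ext_eq_ext_inner)
open Summit.QuantumFields.BalabanUV.T4Continuum.RegionGaugeResolventSplit (gaugeFixed_eq_localFixed_sub)
open Summit.QuantumFields.BalabanUV.T4Continuum.RegionTwoZoneLocal (Collared localTZ form_localTZ form_gaugeFixed_le_form_localTZ gamTZ gamTZ_pos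
  isUnit_det_localTZ opNorm_inv_localTZ_le gradEnergy_le_form_localTZ)
open Summit.QuantumFields.BalabanUV.T4Continuum.RegionTwoZoneScalar
open Summit.QuantumFields.BalabanUV.Beta.GAN24.DirichletBoxTrace (blockReg)

variable {d : ℕ} (n : ℕ) [NeZero n] (M : Fin d → ℕ) [hM : ∀ μ, NeZero (M μ)] (a a' : ℝ) (S₀ S₁ : Tor M → Prop)
  [DecidablePred S₀] [DecidablePred S₁]

/-! ## §2 The structural identities (`SliceData`) for print's collared data -/

omit [DecidablePred S₁] in
/-- the Ω₀-gradient of a scalar vanishing off `Ω₁` vanishes on every bond not touching `Ω₁`. [folklore] -/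
theorem gradR_apply_eq_zero_of_not_star (lam : {x // blockReg n M S₀ x} → ℂ) (hlam : ∀ x : {x // blockReg n M S₀ x}, ¬ blockReg n M S₁ x.1 → lam x = 0)
    (b : {b // starReg n M S₀ b}) (hb : ¬ starReg n M S₁ b.1) : (gradR n M S₀ *ᵥ lam) b = 0 := by
  simp only [gradR, Matrix.mulVec, dotProduct, Matrix.toBlock_apply]
  refine Finset.sum_eq_zero fun x _ => ?_
  by_cases hx : blockReg n M S₁ x.1
  · rw [GradOp_apply_eq_zero_of_not_star n M S₁ hb hx, zero_mul]
  · rw [hlam x hx, mul_zero]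

/-- **THE KERNEL INCLUSION** behind «Q∂ = ∂₁Q′»: for `λ ∈ N(Q′)`, `Qv₂·(∂_{Ω₀}λ) = 0` — the unit rows by «Q∂ = ∂₁Q′» through `Ω₀`
(`avgR_mul_gradR`, all `Ω₀`-block means vanish), the collar rows because a collar bond has no end in `Ω₁`.
[cite: Balaban1984PropagatorsI, (1.55) p.27 (shape)] [folklore] -/
theorem Qv₂_gradR_mulVec_of_ker (lam : {x // blockReg n M S₀ x} → ℂ) (h : QsC n M S₀ S₁ *ᵥ lam = 0) :
    Qv₂ n M S₀ S₁ *ᵥ (gradR n M S₀ *ᵥ lam) = 0 := by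
  obtain ⟨h1, h2⟩ := (ker_QsC_iff n M S₀ S₁ lam).mp h
  have hQ : avgR n M S₀ *ᵥ (gradR n M S₀ *ᵥ lam) = 0 := by
    rw [Matrix.mulVec_mulVec, avgR_mul_gradR, ← Matrix.mulVec_mulVec, QOm_eq_zero_of_ker n M S₀ S₁ lam h1 h2, Matrix.mulVec_zero]
  have hlam : ∀ x : {x // blockReg n M S₀ x}, ¬ blockReg n M S₁ x.1 → lam x = 0 := fun x hx => by
    have h := congrFun h2 ⟨x.1, x.2, hx⟩
    rwa [selS_mulVec] at h
  have hC : selC n M S₀ S₁ *ᵥ (gradR n M S₀ *ᵥ lam) = 0 := by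
    rw [selC_mulVec]
    funext c
    exact gradR_apply_eq_zero_of_not_star n M S₀ S₁ lam hlam ⟨c.1, c.2.1⟩ c.2.2
  rw [Qv₂, Matrix.fromRows_mulVec, Matrix.smul_mulVec, Matrix.smul_mulVec, hQ, hC, smul_zero, smul_zero]
  funext i; rcases i with _ | _ <;> rfl

/-- THE INTERTWINER of «Q∂ = ∂₁Q′» for the collared data, produced by `factor_of_ker`. [folklore] -/
def Dg₁C : Matrix ((Tor M × Fin d) ⊕ {b // collar n M S₀ S₁ b}) ({y // S₁ y} ⊕ {x // collarSite n M S₀ S₁ x}) ℂ :=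
  (((((n : ℝ) ^ d)⁻¹)⁻¹ : ℝ) : ℂ) • ((Qv₂ n M S₀ S₁ * gradR n M S₀) * (QsC n M S₀ S₁)ᴴ)

/-- «Q∂ = ∂₁Q′» for the collared data: `Qv₂·∂_{Ω₀} = Dg₁C·Q′`. [cite: Balaban1984PropagatorsI, (1.55) p.27 (shape)] [folklore] -/
theorem Qv₂_mul_gradR (hsub : ∀ y, S₁ y → S₀ y) : Qv₂ n M S₀ S₁ * gradR n M S₀ = Dg₁C n M S₀ S₁ * QsC n M S₀ S₁ := by
  have hθ : ((n : ℝ) ^ d)⁻¹ ≠ 0 := inv_ne_zero (pow_ne_zero d (by exact_mod_cast NeZero.ne n))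
  have h := factor_of_ker (Qv₂ n M S₀ S₁ * gradR n M S₀) (QsC n M S₀ S₁) hθ (QsC_mul_conjTranspose n M S₀ S₁ hsub)
    (fun lam hlam => by rw [← Matrix.mulVec_mulVec]; exact Qv₂_gradR_mulVec_of_ker n M S₀ S₁ lam hlam)
  unfold Dg₁C
  exact h

/-- **THE STRUCTURAL IDENTITIES OF `SliceData` HOLD FOR PRINT's COLLARED DATA** (`S₁ ≤ S₀`, `0 < a′`).
[cite: Balaban1985BackgroundPropagators, (3.20)–(3.26) pp.394–395 (shapes)] [folklore] -/
theorem sliceData_collar (hsub : ∀ y, S₁ y → S₀ y) (ha' : 0 < a') :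
    SliceData (curlR n M S₀) (gradR n M S₀) (DpC n M a' S₀ S₁) (GOmC n M a' S₀ S₁) (QsC n M S₀ S₁) (Qv₂ n M S₀ S₁) (Dg₁C n M S₀ S₁) where
  curl_grad := curlR_mul_gradR n M S₀
  avg_grad := Qv₂_mul_gradR n M S₀ S₁ hsub
  lap_of_ker := DpC_mulVec_of_ker n M a' S₀ S₁
  herm := GOmC_isHermitian n M a' S₀ S₁
  G_mul := GOmC_mul_DpC n M a' S₀ S₁ ha'
  mul_G := DpC_mul_GOmC n M a' S₀ S₁ ha'
  gram_unit := by
    rcases isEmpty_or_nonempty {x // blockReg n M S₀ x} with hE | hN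
    · -- no sites: `S₁`-blocks and collar sites are empty too, the Gram matrix is `0 × 0`
      haveI : IsEmpty ({y // S₁ y} ⊕ {x // collarSite n M S₀ S₁ x}) := by
        refine ⟨fun i => ?_⟩
        rcases i with y | c
        · exact hE.false ⟨bpt n M y.1 (fun _ => 0), by
            show S₀ (blockOf n M _); rw [blockOf_bpt]; exact hsub _ y.2⟩
        · exact hE.false ⟨c.1, c.2.1⟩
      rw [Matrix.det_isEmpty]; exact isUnit_one
    · have hD : 0 < ‖DpC n M a' S₀ S₁‖ := norm_pos_of_mul_eq_one _ (DpC_mul_GOmC n M a' S₀ S₁ ha')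
      exact isUnit_det_gramK _ _ (GOmC_isHermitian n M a' S₀ S₁) (DpC_mul_GOmC n M a' S₀ S₁ ha') hD
        (inv_pos.mpr (pow_pos (by exact_mod_cast Nat.pos_of_ne_zero (NeZero.ne n)) d)) (QsC_mul_conjTranspose n M S₀ S₁ hsub)

/-! ## §3 Print's collared gauge-fixed operator -/

/-- **PRINT's TWO-ZONE GAUGE-FIXED OPERATOR** `Δ_a(Ω₀) = ∂*∂ + ∂_{Ω₀}·R(Ω₀)·∂_{Ω₀}* + a n^d QᴴQ + a n²·1_{Λ₀}` on the star bonds of `Ω₀`, `R(Ω₀)`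
the projection in `L²(Ω₀)` onto `Δ′N(Q′)`. [cite: Balaban1985BackgroundPropagators, (3.26)–(3.27) p.395 (shape)] [folklore] -/
def regionDeltaC : Matrix {b // starReg n M S₀ b} {b // starReg n M S₀ b} ℂ :=
  gaugeFixed (curlR n M S₀) (gradR n M S₀) (GOmC n M a' S₀ S₁) (QsC n M S₀ S₁) (Qv₂ n M S₀ S₁) a

/-- **THE RESOLVENT SPLIT, PRINT's VERSION**: `Δ_a(Ω₀) = localTZ − ∂_{Ω₀}·P(Ω₀)·∂_{Ω₀}ᴴ` — file 1's LOCAL operator minus the collared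
sandwich. [cite: Balaban1985BackgroundPropagators, (3.25)–(3.26) pp.394–395 (shape: R = I − P)] [folklore] -/
theorem regionDeltaC_eq_localTZ_sub :
    regionDeltaC n M a a' S₀ S₁
      = localTZ n M a S₀ S₁ - gradR n M S₀ * gaugeP (GOmC n M a' S₀ S₁) (QsC n M S₀ S₁) * (gradR n M S₀)ᴴ :=
  gaugeFixed_eq_localFixed_sub _ _ _ _ _ _

/-- its quadratic form: `re⟨A, Δ_a(Ω₀)A⟩ = ‖curl A‖² + ‖R(Ω₀)·∂_{Ω₀}ᴴA‖² + a n^d‖QA‖² + a n²‖A_{Λ₀}‖²`.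
[cite: Balaban1984PropagatorsI, (1.69) p.29 (shape)] [folklore] -/
theorem form_regionDeltaC (hsub : ∀ y, S₁ y → S₀ y) (ha' : 0 < a') (A : {b // starReg n M S₀ b} → ℂ) :
    (star A ⬝ᵥ (regionDeltaC n M a a' S₀ S₁ *ᵥ A)).re
      = nsq (curlR n M S₀ *ᵥ A) + nsq (gaugeR (GOmC n M a' S₀ S₁) (QsC n M S₀ S₁) *ᵥ ((gradR n M S₀)ᴴ *ᵥ A))
          + a * ((n : ℝ) ^ d * nsq (avgR n M S₀ *ᵥ A) + (n : ℝ) ^ 2 * nsq (selC n M S₀ S₁ *ᵥ A)) := by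
  rw [regionDeltaC, form_gaugeFixed _ _ _ _ _ _ (GOmC_isHermitian n M a' S₀ S₁) (sliceData_collar n M a' S₀ S₁ hsub ha').gram_unit,
    nsq_Qv₂_mulVec]

/-- the faithful operator is dominated by file 1's local operator (instance of `form_gaugeFixed_le_form_localTZ`). [folklore] -/
theorem form_regionDeltaC_le_form_localTZ (hsub : ∀ y, S₁ y → S₀ y) (ha' : 0 < a') (A : {b // starReg n M S₀ b} → ℂ) :
    (star A ⬝ᵥ (regionDeltaC n M a a' S₀ S₁ *ᵥ A)).re ≤ (star A ⬝ᵥ (localTZ n M a S₀ S₁ *ᵥ A)).re :=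
  form_gaugeFixed_le_form_localTZ n M a S₀ S₁ _ _ (GOmC_isHermitian n M a' S₀ S₁)
    (sliceData_collar n M a' S₀ S₁ hsub ha').gram_unit A

/-- **«G(Ω₀) EXISTS» FOR EVERY COLLARED PAIR** (`S₁ ≤ S₀`, `0 < a`, `0 < a′`; no coercivity constant — that is the slice inequality):
zero averages kill the collar components, and a curl-free field with zero unit averages supported on the star bonds of `Ω₁` is a pure gauge of
`Ω₁` (`flat_region`), extended by zero to a gauge in `N(Q′)`. [cite: Balaban1985BackgroundPropagators, (3.27) p.395 (shape)] [folklore] -/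
theorem isUnit_det_regionDeltaC (hsub : ∀ y, S₁ y → S₀ y) (ha : 0 < a) (ha' : 0 < a') :
    IsUnit (regionDeltaC n M a a' S₀ S₁).det := by
  refine isUnit_det_gaugeFixed_of_flat _ (sliceData_collar n M a' S₀ S₁ hsub ha') ha ?_
  intro A hC hQ
  rw [Qv₂, Matrix.fromRows_mulVec, Matrix.smul_mulVec, Matrix.smul_mulVec] at hQ
  have hsq : ((((Real.sqrt ((n : ℝ) ^ d)) : ℝ) : ℂ)) ≠ 0 := by
    have : 0 < Real.sqrt ((n : ℝ) ^ d) := Real.sqrt_pos.mpr (pow_pos (by exact_mod_cast Nat.pos_of_ne_zero (NeZero.ne n)) d)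
    exact_mod_cast this.ne'
  have hnC : (n : ℂ) ≠ 0 := by exact_mod_cast NeZero.ne n
  have hQ1 : avgR n M S₀ *ᵥ A = 0 := by
    have h := congrArg (fun v => v ∘ Sum.inl) hQ
    simp only [Function.comp_def, Sum.elim_inl, Pi.zero_apply] at h
    exact (smul_eq_zero.mp (funext fun i => congrFun h i)).resolve_left hsq
  have hcol : selC n M S₀ S₁ *ᵥ A = 0 := by
    have h := congrArg (fun v => v ∘ Sum.inr) hQ
    simp only [Function.comp_def, Sum.elim_inr, Pi.zero_apply] at h
    exact (smul_eq_zero.mp (funext fun i => congrFun h i)).resolve_left hnC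
  have hext := ext_eq_ext_inner n M S₀ S₁ hsub A hcol
  have hC1 : curlR n M S₁ *ᵥ inner n M S₀ S₁ hsub A = 0 := by
    rw [curlR_mulVec, ← hext, ← curlR_mulVec]; exact hC
  have hQ1' : avgR n M S₁ *ᵥ inner n M S₀ S₁ hsub A = 0 := by
    rw [avgR_mulVec, ← hext, ← avgR_mulVec]; exact hQ1
  obtain ⟨lam₁, hlam₁, hA1⟩ := flat_region n M S₁ (inner n M S₀ S₁ hsub A) hC1 hQ1'
  -- extend the Ω₁-gauge by zero to Ω₀
  refine ⟨fun x => if h : blockReg n M S₁ x.1 then lam₁ ⟨x.1, h⟩ else 0, ?_, ?_⟩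
  · -- it lies in `N(Q′)`
    refine (ker_QsC_iff n M S₀ S₁ _).mpr ⟨?_, ?_⟩
    · funext y
      have h := congrFun hlam₁ y
      simp only [QOm, Matrix.mulVec, dotProduct, Matrix.toBlock_apply, Pi.zero_apply] at h ⊢
      simp only [Q1, Matrix.toBlock_apply]
      rw [sum_extend n M S₀ S₁ hsub]
      exact h
    · rw [selS_mulVec]
      funext c
      simp only [Pi.zero_apply]
      rw [dif_neg c.2.2]
  · -- it generates `A`
    funext b
    by_cases h1 : starReg n M S₁ b.1
    · have e1 : A b = inner n M S₀ S₁ hsub A ⟨b.1, h1⟩ := rfl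
      rw [e1, hA1]
      simp only [gradR, Matrix.mulVec, dotProduct, Matrix.toBlock_apply]
      rw [sum_extend n M S₀ S₁ hsub]
    · have e1 : A b = 0 := by
        have h := congrFun hcol ⟨b.1, b.2, h1⟩
        rwa [selC_mulVec] at h
      rw [e1]
      exact (gradR_apply_eq_zero_of_not_star n M S₀ S₁ _ (fun x hx => by simp only [dif_neg hx]) b h1).symm

/-- **«… WITH `‖G(Ω₀)‖ ≤ max(2/c, 2γ′⁻¹)`» FROM ONE DISPLAYED SLICE INEQUALITY** — W1 for PRINT's collared operator, NOT proved here.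
[cite: Balaban1985BackgroundPropagators, (3.27) p.395 (shape)] [folklore] -/
theorem opNorm_inv_regionDeltaC_le_of_slice (hsub : ∀ y, S₁ y → S₀ y) (ha' : 0 < a') {c : ℝ} (hc : 0 < c)
    (hS : SliceCoercive (curlR n M S₀) (gradR n M S₀) (GOmC n M a' S₀ S₁) (QsC n M S₀ S₁) (Qv₂ n M S₀ S₁) a c) :
    ‖(regionDeltaC n M a a' S₀ S₁)⁻¹‖ ≤ (min (c / 2) (1 / (2 * (gammaPs d a')⁻¹)))⁻¹ :=
  opNorm_inv_gaugeFixed_le_of_slice _ (sliceData_collar n M a' S₀ S₁ hsub ha') hc hS (opNorm_GOmC_le n M a' S₀ S₁ ha')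
    (inv_pos.mpr (gammaPs_pos (d := d) (a' := a')).1)

/-- conversely a coercivity constant of `Δ_a(Ω₀)` IS a slice constant. [folklore] -/
theorem sliceCoercive_collar_of_coercive (hsub : ∀ y, S₁ y → S₀ y) (ha' : 0 < a') {γ : ℝ} (h : Coercive (regionDeltaC n M a a' S₀ S₁) γ) :
    SliceCoercive (curlR n M S₀) (gradR n M S₀) (GOmC n M a' S₀ S₁) (QsC n M S₀ S₁) (Qv₂ n M S₀ S₁) a γ :=
  sliceCoercive_of_coercive _ (GOmC_isHermitian n M a' S₀ S₁) (sliceData_collar n M a' S₀ S₁ hsub ha').gram_unit h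


/-! ## §4 Budgets of the LOCAL collared propagator `localTZ⁻¹` (file 1's coercivity, in the owner's `Ebud` style) -/

section Budgets

variable {S₀ S₁}

/-- `localTZ·(localTZ⁻¹ f) = f`. [folklore] -/
theorem localTZ_mulVec_inv (hsub : ∀ y, S₁ y → S₀ y) (hcol : Collared n M S₀ S₁) (hn : 1 ≤ n) (ha : 0 < a)
    (f : {b // starReg n M S₀ b} → ℂ) : localTZ n M a S₀ S₁ *ᵥ ((localTZ n M a S₀ S₁)⁻¹ *ᵥ f) = f := by
  rw [Matrix.mulVec_mulVec, Matrix.mul_nonsing_inv _ (isUnit_det_localTZ n M a S₀ S₁ hsub hcol hn ha), Matrix.one_mulVec]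

/-- **AMPLITUDE**: `nsq (localTZ⁻¹ f) ≤ gamTZ⁻²·nsq f`. [folklore] -/
theorem nsq_inv_le (hsub : ∀ y, S₁ y → S₀ y) (hcol : Collared n M S₀ S₁) (hn : 1 ≤ n) (ha : 0 < a)
    (f : {b // starReg n M S₀ b} → ℂ) : nsq ((localTZ n M a S₀ S₁)⁻¹ *ᵥ f) ≤ ((gamTZ d a)⁻¹) ^ 2 * nsq f := by
  refine (nsq_mulVec_le _ f).trans (mul_le_mul_of_nonneg_right ?_ (nsq_nonneg f))
  exact pow_le_pow_left₀ (norm_nonneg _) (opNorm_inv_localTZ_le n M a S₀ S₁ hsub hcol hn ha) 2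

/-- **ENERGY**: `re⟨localTZ⁻¹ f, f⟩ ≤ gamTZ⁻¹·nsq f` (the form of the local collared propagator). [folklore] -/
theorem form_inv_le (hsub : ∀ y, S₁ y → S₀ y) (hcol : Collared n M S₀ S₁) (hn : 1 ≤ n) (ha : 0 < a)
    (f : {b // starReg n M S₀ b} → ℂ) :
    (star ((localTZ n M a S₀ S₁)⁻¹ *ᵥ f) ⬝ᵥ (localTZ n M a S₀ S₁ *ᵥ ((localTZ n M a S₀ S₁)⁻¹ *ᵥ f))).re ≤ (gamTZ d a)⁻¹ * nsq f := by
  set u := (localTZ n M a S₀ S₁)⁻¹ *ᵥ f with hu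
  have hγ := gamTZ_pos (d := d) a ha
  rw [localTZ_mulVec_inv n M a hsub hcol hn ha f]
  have h1 := re_star_dotProduct_le u f
  have h2 : Real.sqrt (nsq u) ≤ (gamTZ d a)⁻¹ * Real.sqrt (nsq f) := by
    have h := nsq_inv_le n M a hsub hcol hn ha f
    rw [← hu] at h
    calc Real.sqrt (nsq u) ≤ Real.sqrt (((gamTZ d a)⁻¹) ^ 2 * nsq f) := Real.sqrt_le_sqrt h
      _ = (gamTZ d a)⁻¹ * Real.sqrt (nsq f) := by
        rw [Real.sqrt_mul (sq_nonneg _), Real.sqrt_sq (inv_nonneg.mpr hγ.le)]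
  calc (star u ⬝ᵥ f).re ≤ Real.sqrt (nsq u) * Real.sqrt (nsq f) := h1
    _ ≤ (gamTZ d a)⁻¹ * Real.sqrt (nsq f) * Real.sqrt (nsq f) := by gcongr
    _ = (gamTZ d a)⁻¹ * nsq f := by rw [mul_assoc, Real.mul_self_sqrt (nsq_nonneg _)]

/-- **THE COLLAR AMPLITUDE OF THE LOCAL PROPAGATOR**: `a n²·nsq (selC (localTZ⁻¹ f)) ≤ gamTZ⁻¹·nsq f` — on the η-massive layer the local
collared propagator is `O(n⁻¹)` in amplitude, uniformly (the weight a currency-corrected (R-loc) budget would carry). [folklore] -/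
theorem collar_nsq_inv_le (hsub : ∀ y, S₁ y → S₀ y) (hcol : Collared n M S₀ S₁) (hn : 1 ≤ n) (ha : 0 < a)
    (f : {b // starReg n M S₀ b} → ℂ) :
    a * (n : ℝ) ^ 2 * nsq (selC n M S₀ S₁ *ᵥ ((localTZ n M a S₀ S₁)⁻¹ *ᵥ f)) ≤ (gamTZ d a)⁻¹ * nsq f := by
  have h := form_inv_le n M a hsub hcol hn ha f
  rw [form_localTZ] at h
  have h1 := nsq_nonneg (curlR n M S₀ *ᵥ ((localTZ n M a S₀ S₁)⁻¹ *ᵥ f))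
  have h2 := nsq_nonneg ((gradR n M S₀)ᴴ *ᵥ ((localTZ n M a S₀ S₁)⁻¹ *ᵥ f))
  have h3 : 0 ≤ a * (n : ℝ) ^ d * nsq (avgR n M S₀ *ᵥ ((localTZ n M a S₀ S₁)⁻¹ *ᵥ f)) := by
    have := nsq_nonneg (avgR n M S₀ *ᵥ ((localTZ n M a S₀ S₁)⁻¹ *ᵥ f)); positivity
  linarith

/-- **THE FULL GRADIENT ENERGY OF THE LOCAL PROPAGATOR**: `Σ_ν nsq (fdiff ν (ext (localTZ⁻¹ f))) ≤ (1 + 4d/a)·gamTZ⁻¹·nsq f`, on every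
inner geometry (file 1's `gradEnergy_le_form_localTZ` + `form_inv_le`). [folklore] -/
theorem gradEnergy_inv_le (hsub : ∀ y, S₁ y → S₀ y) (hcol : Collared n M S₀ S₁) (hn : 1 ≤ n) (ha : 0 < a)
    (f : {b // starReg n M S₀ b} → ℂ) :
    ∑ ν, nsq (fdiff (fine n M) (n : ℂ) ν *ᵥ ext (starReg n M S₀) ((localTZ n M a S₀ S₁)⁻¹ *ᵥ f))
      ≤ (1 + 4 * d / a) * ((gamTZ d a)⁻¹ * nsq f) := by
  have h := gradEnergy_le_form_localTZ n M a S₀ S₁ hsub hcol ha ((localTZ n M a S₀ S₁)⁻¹ *ᵥ f)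
  have hd : (0 : ℝ) ≤ 1 + 4 * d / a := by positivity
  exact h.trans (mul_le_mul_of_nonneg_left (form_inv_le n M a hsub hcol hn ha f) hd)

end Budgets

end Summit.QuantumFields.BalabanUV.T4Continuum.RegionTwoZoneGauge

end
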